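import Summits.CriticalPhenomena.CardyFormulaZ2.Theses.CardyRotToConf
import Literature.Probability.RandomPlanarGeometry.ChordalCurveFamilyProofs
import Literature.Probability.RandomPlanarGeometry.BrownianLoopMarkedDecomposition
import HarnessLib

/-!
# `CurveClass.stopAt F` and `CurveClass.startFrom F` are Borel measurable (closed `F`)
# (typed axioms of `CardyRotToConfR2SymmetryUpgrade`, stmt-CriticalPhenomena-0698)

By-product of the cdisprove unit (standing adversary, cycle 3). The typed locality, target
independence and Markov axioms of `ChordalFamily` evaluate laws on the sets
`CurveClass.stopAt F ⁻¹' T`, `CurveClass.startFrom F ⁻¹' T` for CLOSED `F` and measurable `T`,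
deliberately without asserting measurability of the surgery maps (design note of
`ChordalCurveFamily`: "nothing silently degenerates to `0 = 0`"). For any family CONSTRUCTED by a
push-forward — the one-shot surgery `J† = chord ⋆ S(E_q)` of the disprover's programme
(Disproof.lean §13) as much as the provers' limit families of `LimitFamily` / `LagHandOff` — these
sets must be known to be measurable, else `Measure.map` cannot be evaluated on them. This file
proves it:

* `lowerSemicontinuous_hitParam` — on parametrised curves `C([0,1], E)` with the sup metric, the
  first hitting parameter of a closed set is lower semicontinuous (a curve that has not met `F`
  by time `s` keeps a positive distance from `F` on `[0, s]`), hence Borel;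
* `measurable_stopCM`, `measurable_startCM` — the parametrised surgeries
  `γ ↦ γ ∘ affineClamp 0 T(γ)`, `γ ↦ γ ∘ affineClamp T(γ) (1 - T(γ))` are Borel;
* `curveClass_measurable_of_lift` — a self-map of `CurveClass ℂ` that lifts to a Borel self-map
  of `C([0,1], ℂ)` along `mkCM` is Borel: preimages and their complements are continuous images
  of Borel subsets of a Polish space, i.e. analytic and co-analytic, hence Borel by SUSLIN's
  theorem (`MeasureTheory.AnalyticSet.measurableSet_of_compl`);
* `measurable_stopAt`, `measurable_startFrom` (closed `F`), and the
  corollaries `measurableSet_preimage_stopAt`, `measurableSet_preimage_startFrom`,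
  `map_apply_preimage_stopAt` (push-forwards CAN be evaluated on the sets of the typed axioms).
-/

noncomputable section

open Set Filter Topology Metric MeasureTheory
open scoped unitInterval

namespace Summit.CriticalPhenomena.CardyFormulaZ2.Theorems.CardyRotToConfR2SymmetryUpgrade.Negative

open Literature.Probability.RandomPlanarGeometry
open Literature.Probability.RandomPlanarGeometry.BrownianLoop

/-! ### Lower semicontinuity of the hitting parameter on parametrised curves -/

section Param

variable {E : Type*} [MetricSpace E]

/-- A curve all of whose values up to parameter `s` avoid `F` has hitting parameter `≥ s`
(`s ≤ 1`). [folklore] -/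
theorem le_hitParam_of_forall_notMem {F : Set E} {γ : Curve E} {s : ℝ} (hs : s ≤ 1)
    (h : ∀ t : I, (t : ℝ) ≤ s → γ t ∉ F) : s ≤ γ.hitParam F := by
  refine le_csInf ⟨1, γ.one_mem_hitSet F⟩ ?_
  rintro t (⟨ht, hmem⟩ | ht)
  · by_contra hlt
    exact h ⟨t, ht⟩ (not_le.1 hlt).le hmem
  · rw [mem_singleton_iff.1 ht]
    exact hs

/-- Before the hitting parameter of a CLOSED set the curve avoids it. [folklore] -/
theorem notMem_of_lt_hitParam {F : Set E} {γ : Curve E} {t : I} (ht : (t : ℝ) < γ.hitParam F) :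
    γ t ∉ F := fun hmem =>
  absurd (Curve.hitParam_le hmem) (not_le.2 ht)

/-- **The first hitting parameter of a closed set is lower semicontinuous** on `C([0,1], E)` with
the sup metric. [folklore] -/
theorem lowerSemicontinuous_hitParam {F : Set E} (hF : IsClosed F) :
    LowerSemicontinuous fun γ : C(I, E) => (Curve.mk γ).hitParam F := by
  intro γ₀ s hs
  -- negative thresholds are trivial (`hitParam ≥ 0`)
  rcases lt_or_ge s 0 with hs0 | hs0
  · exact Filter.Eventually.of_forall fun γ => hs0.trans_le ((Curve.mk γ).hitParam_mem_Icc F).1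
  -- `0 ≤ s < T₀ ≤ 1`; pick `s < s' < T₀`
  set T₀ := (Curve.mk γ₀).hitParam F with hT₀
  have hT₀1 : T₀ ≤ 1 := ((Curve.mk γ₀).hitParam_mem_Icc F).2
  obtain ⟨s', hss', hs'T⟩ := exists_between hs
  rcases F.eq_empty_or_nonempty with rfl | hFne
  · -- empty set: `hitParam = 1` everywhere
    refine Filter.Eventually.of_forall fun γ => ?_
    have : (Curve.mk γ).hitParam (∅ : Set E) = 1 :=
      Curve.hitParam_eq_one_of_forall_notMem fun t => Set.notMem_empty _
    show s < (Curve.mk γ).hitParam (∅ : Set E)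
    rw [this]
    exact hs.trans_le hT₀1
  -- compact initial piece `K = γ₀ '' {t ≤ s'}` is disjoint from `F`, at positive distance
  have hKc : IsCompact (γ₀ '' {t : I | (t : ℝ) ≤ s'}) :=
    ((isClosed_le continuous_subtype_val continuous_const).isCompact).image γ₀.continuous
  set K : Set E := γ₀ '' {t : I | (t : ℝ) ≤ s'} with hK
  have hKF : ∀ x ∈ K, 0 < infDist x F := by
    rintro _ ⟨t, ht, rfl⟩
    rw [← hF.notMem_iff_infDist_pos hFne]
    exact notMem_of_lt_hitParam (ht.trans_lt hs'T)
  -- positive lower bound `δ` of `infDist · F` on `K` (`K` contains `γ₀ 0`)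
  have hKne : K.Nonempty := ⟨γ₀ 0, 0, show ((0 : I) : ℝ) ≤ s' by
    simp only [Set.Icc.coe_zero]; linarith, rfl⟩
  obtain ⟨x₀, hx₀K, hx₀min⟩ :=
    hKc.exists_isMinOn hKne (continuous_infDist_pt F).continuousOn
  set δ := infDist x₀ F with hδ
  have hδpos : 0 < δ := hKF x₀ hx₀K
  -- curves within sup distance `δ` of `γ₀` avoid `F` up to time `s'`
  have key : ∀ γ : C(I, E), dist γ γ₀ < δ → s' ≤ (Curve.mk γ).hitParam F := by
    intro γ hγ
    refine le_hitParam_of_forall_notMem (hs'T.le.trans hT₀1) fun t ht hmem => ?_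
    have h1 : δ ≤ infDist (γ₀ t) F := hx₀min (mem_image_of_mem _ ht)
    have h2 : infDist (γ₀ t) F ≤ dist (γ₀ t) (γ t) := infDist_le_dist_of_mem hmem
    have h3 : dist (γ₀ t) (γ t) < δ := by
      rw [dist_comm]
      exact (ContinuousMap.dist_apply_le_dist t).trans_lt hγ
    linarith
  filter_upwards [Metric.ball_mem_nhds γ₀ hδpos] with γ hγ
  exact hss'.trans_le (key γ (mem_ball.1 hγ))

/-- The hitting parameter is a Borel function on `C([0,1], E)`. [folklore] -/
theorem measurable_hitParam [MeasurableSpace C(I, E)] [OpensMeasurableSpace C(I, E)] {F : Set E}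
    (hF : IsClosed F) : Measurable fun γ : C(I, E) => (Curve.mk γ).hitParam F :=
  (lowerSemicontinuous_hitParam hF).measurable

/-- `T ↦ affineClamp a(T) b(T)` is continuous into `C([0,1],[0,1])` for continuous `a`, `b`.
[folklore] -/
theorem continuous_affineClamp {a b : ℝ → ℝ} (ha : Continuous a) (hb : Continuous b) :
    Continuous fun T : ℝ => Curve.affineClamp (a T) (b T) := by
  let G : C(ℝ × I, I) :=
    ⟨fun p => Set.projIcc 0 1 zero_le_one (a p.1 + b p.1 * p.2),
      continuous_projIcc.comp ((ha.comp continuous_fst).add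
        ((hb.comp continuous_fst).mul (continuous_subtype_val.comp continuous_snd)))⟩
  have : (fun T : ℝ => Curve.affineClamp (a T) (b T)) = fun T => G.curry T := by
    funext T
    ext s
    rfl
  rw [this]
  exact G.curry.continuous

/-- The parametrised STOP surgery `γ ↦ γ ∘ affineClamp 0 (hitParam F γ)` is Borel on
`C([0,1], E)`. [folklore] -/
theorem measurable_stopCM [MeasurableSpace C(I, E)] [BorelSpace C(I, E)] {F : Set E}
    (hF : IsClosed F) :
    Measurable fun γ : C(I, E) => γ.comp (Curve.affineClamp 0 ((Curve.mk γ).hitParam F)) := by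
  have hc : Continuous fun p : C(I, E) × ℝ => p.1.comp (Curve.affineClamp 0 p.2) :=
    ContinuousMap.continuous_comp'.comp
      ((continuous_affineClamp continuous_const continuous_id).comp continuous_snd |>.prodMk
        continuous_fst)
  exact hc.measurable.comp (measurable_id.prodMk (measurable_hitParam hF))

/-- The parametrised START surgery `γ ↦ γ ∘ affineClamp T (1 - T)`, `T = hitParam F γ`, is Borel.
[folklore] -/
theorem measurable_startCM [MeasurableSpace C(I, E)] [BorelSpace C(I, E)] {F : Set E}
    (hF : IsClosed F) :
    Measurable fun γ : C(I, E) =>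
      γ.comp (Curve.affineClamp ((Curve.mk γ).hitParam F) (1 - (Curve.mk γ).hitParam F)) := by
  have hc : Continuous fun p : C(I, E) × ℝ => p.1.comp (Curve.affineClamp p.2 (1 - p.2)) :=
    ContinuousMap.continuous_comp'.comp
      ((continuous_affineClamp continuous_id (continuous_const.sub continuous_id)).comp
        continuous_snd |>.prodMk continuous_fst)
  exact hc.measurable.comp (measurable_id.prodMk (measurable_hitParam hF))

end Param

/-! ### From parametrised curves to classes: Suslin -/

section Quotient

open Literature

/-- `mkCM : C([0,1], ℂ) → CurveClass ℂ` is surjective. [folklore] -/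
theorem surjective_mkCM : Function.Surjective (mkCM : C(I, ℂ) → CurveClass ℂ) := fun c => by
  obtain ⟨γ, rfl⟩ := CurveClass.surjective_mk c
  exact ⟨γ.toContinuousMap, rfl⟩

/-- **A self-map of curve classes that lifts to a Borel self-map of parametrised curves is
Borel** (Suslin: its preimages of Borel sets and their complements are analytic). [folklore] -/
theorem curveClass_measurable_of_lift
    {g : CurveClass ℂ → CurveClass ℂ} {ĝ : C(I, ℂ) → C(I, ℂ)}
    (hĝ : ∀ [MeasurableSpace C(I, ℂ)] [BorelSpace C(I, ℂ)], Measurable ĝ)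
    (h : ∀ γ : C(I, ℂ), g (mkCM γ) = mkCM (ĝ γ)) : Measurable g := by
  letI : MeasurableSpace C(I, ℂ) := borel _
  haveI : BorelSpace C(I, ℂ) := ⟨rfl⟩
  have hπ : Measurable (mkCM : C(I, ℂ) → CurveClass ℂ) := lipschitzWith_mkCM.continuous.measurable
  have himage : ∀ A : Set (CurveClass ℂ), g ⁻¹' A = mkCM '' (ĝ ⁻¹' (mkCM ⁻¹' A)) := by
    intro A
    ext c
    constructor
    · intro hc
      obtain ⟨γ, rfl⟩ := surjective_mkCM c
      refine ⟨γ, ?_, rfl⟩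
      show mkCM (ĝ γ) ∈ A
      rw [← h]
      exact hc
    · rintro ⟨γ, hγ, rfl⟩
      show g (mkCM γ) ∈ A
      rw [h]
      exact hγ
  intro A hA
  refine AnalyticSet.measurableSet_of_compl ?_ ?_
  · rw [himage]
    exact ((hA.preimage hπ).preimage hĝ).analyticSet_image hπ
  · rw [← Set.preimage_compl, himage]
    exact ((hA.compl.preimage hπ).preimage hĝ).analyticSet_image hπ

/-- **`CurveClass.stopAt F` is Borel measurable for closed `F`.** [folklore] -/
theorem measurable_stopAt
    {F : Set ℂ} (hF : IsClosed F) :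
    Measurable (CurveClass.stopAt F : CurveClass ℂ → CurveClass ℂ) := by
  refine curveClass_measurable_of_lift (ĝ := fun γ : C(I, ℂ) =>
    γ.comp (Curve.affineClamp 0 ((Curve.mk γ).hitParam F))) (fun {_ _} => measurable_stopCM hF)
    fun γ => ?_
  show CurveClass.stopAt F (CurveClass.mk (Curve.mk γ)) = CurveClass.mk (Curve.mk _)
  rw [CurveClass.stopAt_mk_holds F hF]
  rfl

/-- **`CurveClass.startFrom F` is Borel measurable for closed `F`.** [folklore] -/
theorem measurable_startFrom
    {F : Set ℂ} (hF : IsClosed F) :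
    Measurable (CurveClass.startFrom F : CurveClass ℂ → CurveClass ℂ) := by
  refine curveClass_measurable_of_lift (ĝ := fun γ : C(I, ℂ) =>
    γ.comp (Curve.affineClamp ((Curve.mk γ).hitParam F) (1 - (Curve.mk γ).hitParam F)))
    (fun {_ _} => measurable_startCM hF) fun γ => ?_
  show CurveClass.startFrom F (CurveClass.mk (Curve.mk γ)) = CurveClass.mk (Curve.mk _)
  rw [CurveClass.startFrom_mk_holds F hF]
  rfl

/-- The sets of the typed locality / target-independence axioms are measurable. [folklore] -/
theorem measurableSet_preimage_stopAt {F : Set ℂ} (hF : IsClosed F) {T : Set (CurveClass ℂ)}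
    (hT : MeasurableSet T) : MeasurableSet (CurveClass.stopAt F ⁻¹' T) :=
  hT.preimage (measurable_stopAt hF)

/-- The sets of the typed Markov axiom are measurable. [folklore] -/
theorem measurableSet_preimage_startFrom {F : Set ℂ} (hF : IsClosed F) {T : Set (CurveClass ℂ)}
    (hT : MeasurableSet T) : MeasurableSet (CurveClass.startFrom F ⁻¹' T) :=
  hT.preimage (measurable_startFrom hF)

/-- **Push-forwards can be evaluated on the sets of the typed axioms**: for a measurable map
`f` into curve classes, `(μ.map f) (stopAt F ⁻¹' T) = μ (f ⁻¹' (stopAt F ⁻¹' T))`. [folklore] -/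
theorem map_apply_preimage_stopAt {α : Type*} [MeasurableSpace α] {μ : Measure α}
    {f : α → CurveClass ℂ} (hf : Measurable f) {F : Set ℂ} (hF : IsClosed F)
    {T : Set (CurveClass ℂ)} (hT : MeasurableSet T) :
    μ.map f (CurveClass.stopAt F ⁻¹' T) = μ (f ⁻¹' (CurveClass.stopAt F ⁻¹' T)) :=
  Measure.map_apply hf (measurableSet_preimage_stopAt hF hT)

end Quotient

end Summit.CriticalPhenomena.CardyFormulaZ2.Theorems.CardyRotToConfR2SymmetryUpgrade.Negative
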